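import Mathlib.Algebra.MvPolynomial.CommRing
import Mathlib.Algebra.MvPolynomial.Variables
import Mathlib.Data.Nat.Choose.Basic
import Mathlib.Tactic.Ring
import HarnessLib

/-!
# The composition law of the unipotent substitutions `Φ_{(A,Θ,c)}` (instrument, NOT a resolution theorem)

Engine 1 of the RESOLUTION OBSERVATORY toy model `W(f)` (RE-DERIVATION-eng1-g41 §3.7.6; CARVER-NOTES-eng1-g41 T95) uses, for
every two-light-class menu, the following pure algebra.  In `R[x…, y…, z…]` (`R` commutative; in use `R = k[σ]`; the engine's
`f`- and `W`-slots are both "`x`-slots" here — a `W`-slot is an `x`-slot with `Θ_{·,W} = 0`, `A_W = B_W`) let `Φ_{(A,Θ,c)}` be the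
`R`-algebra endomorphism

  `x ↦ x + A_x + Σ_{t ∈ ys} y_t·Θ_{t,x}`,  `y_t ↦ y_t + c_t`,  `z ↦ z`,  with all `A_x, Θ_{t,x}, c_t ∈ R[z]`.

Then (substitution convention `(Φ ∘ Φ′)(v) = Φ(Φ′(v))`)

  `Φ_{(A,Θ,c)} ∘ Φ_{(A′,Θ′,c′)} = Φ_{(A + A′ + Σ_t c_t·Θ′_{t,·}, Θ + Θ′, c + c′)}`   (`IsUnipotentBy.comp`),

because `Φ` fixes `R[z]` pointwise (`IsUnipotentBy.apply_eq_self`); hence `Θ, c` are additive, `Φ^n` has coordinates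
`(nA + (n choose 2)·Σ_t c_tΘ_{t,·}, nΘ, nc)` (`IsUnipotentBy.pow`, `Data.pow_A/_Θ/_c`), and the elements with `Θ = 0` compose by
coordinatewise addition and commute (`Data.comp_of_Θ_eq_zero`, `comp_comm_of_Θ_eq_zero`; T91's situation, cf.
`WeightedCentreAdditiveShifts`).  Also: the substitution is determined by its data (`IsUnipotentBy.unique`), the construction
`unipotentHom` (`isUnipotentBy_unipotentHom`, needs `ys ∩ zs = ∅`), `Φ_0 = id`.

`MvPolynomial.aeval` bookkeeping; no weights, no `(P)`.  References: substitution endomorphisms [SerreLocalFields1979, Ch. II §4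
Lemma 1] (pattern cite); the frame [AbramovichTemkinWlodarczyk2024, Thm. 5.3.1].  All statements are OURS (toy-model bookkeeping).
-/

namespace Literature.AlgebraicGeometry.Resolution.WeightedBlowup

namespace UnipotentComposition

open MvPolynomial

variable {R : Type*} [CommRing R] {ι : Type*}

/-! ## `R[z]` as a predicate -/

/-- `q ∈ R[z]`: only variables of `zs` occur in `q` (ours). [cite: SerreLocalFields1979, Ch. II §4 Lemma 1] -/
def IsOverZ (zs : Finset ι) (q : MvPolynomial ι R) : Prop := ∀ j ∈ q.vars, j ∈ zs

namespace IsOverZ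

variable {zs : Finset ι}

/-- Bookkeeping (ours). [cite: SerreLocalFields1979, Ch. II §4 Lemma 1] -/
theorem zero : IsOverZ zs (0 : MvPolynomial ι R) := fun j hj => by
  rw [vars_0] at hj; exact absurd hj (Finset.notMem_empty j)

/-- Bookkeeping (ours). [cite: SerreLocalFields1979, Ch. II §4 Lemma 1] -/
theorem C (r : R) : IsOverZ zs (C r : MvPolynomial ι R) := fun j hj => by
  rw [vars_C] at hj; exact absurd hj (Finset.notMem_empty j)

/-- Bookkeeping (ours). [cite: SerreLocalFields1979, Ch. II §4 Lemma 1] -/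
theorem X {z : ι} (hz : z ∈ zs) : IsOverZ zs (X z : MvPolynomial ι R) := fun j hj => by
  obtain ⟨d, hd, hjd⟩ := (mem_vars_iff_mem_support j).mp hj
  change d ∈ (monomial (Finsupp.single z 1) (1 : R)).support at hd
  rw [Finset.mem_singleton.mp (support_monomial_subset hd)] at hjd
  rw [Finset.mem_singleton.mp (Finsupp.support_single_subset hjd)]
  exact hz

/-- Bookkeeping (ours). [cite: SerreLocalFields1979, Ch. II §4 Lemma 1] -/
theorem add [DecidableEq ι] {p q : MvPolynomial ι R} (hp : IsOverZ zs p) (hq : IsOverZ zs q) : IsOverZ zs (p + q) :=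
  fun j hj => by
    rcases Finset.mem_union.mp (vars_add_subset _ _ hj) with h | h
    · exact hp j h
    · exact hq j h

/-- Bookkeeping (ours). [cite: SerreLocalFields1979, Ch. II §4 Lemma 1] -/
theorem mul [DecidableEq ι] {p q : MvPolynomial ι R} (hp : IsOverZ zs p) (hq : IsOverZ zs q) : IsOverZ zs (p * q) :=
  fun j hj => by
    rcases Finset.mem_union.mp (vars_mul _ _ hj) with h | h
    · exact hp j h
    · exact hq j h

/-- Bookkeeping (ours). [cite: SerreLocalFields1979, Ch. II §4 Lemma 1] -/
theorem neg {p : MvPolynomial ι R} (hp : IsOverZ zs p) : IsOverZ zs (-p) := fun j hj => by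
  rw [vars_neg] at hj; exact hp j hj

/-- Bookkeeping (ours). [cite: SerreLocalFields1979, Ch. II §4 Lemma 1] -/
theorem sum [DecidableEq ι] {α : Type*} {s : Finset α} {f : α → MvPolynomial ι R} (h : ∀ a ∈ s, IsOverZ zs (f a)) :
    IsOverZ zs (∑ a ∈ s, f a) := fun j hj => by
  obtain ⟨a, ha, hja⟩ := Finset.mem_biUnion.mp (vars_sum_subset _ _ hj)
  exact h a ha j hja

/-- Bookkeeping (ours). [cite: SerreLocalFields1979, Ch. II §4 Lemma 1] -/
theorem nsmul [DecidableEq ι] {p : MvPolynomial ι R} (hp : IsOverZ zs p) (n : ℕ) : IsOverZ zs (n • p) := by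
  rw [nsmul_eq_mul, ← map_natCast (MvPolynomial.C : R →+* MvPolynomial ι R)]
  exact (IsOverZ.C _).mul hp

end IsOverZ

/-! ## The data `(A, Θ, c)` and their composition law -/

/-- The coordinates `(A, Θ, c)` of a unipotent substitution (ours). [cite: SerreLocalFields1979, Ch. II §4 Lemma 1] -/
structure Data (ι R : Type*) [CommRing R] where
  /-- `x ↦ x + A_x + …` -/
  A : ι → MvPolynomial ι R
  /-- `x ↦ … + Σ_t y_t Θ_{t,x}` -/
  Θ : ι → ι → MvPolynomial ι R
  /-- `y_t ↦ y_t + c_t` -/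
  c : ι → MvPolynomial ι R

namespace Data

/-- The data of the identity (ours). [cite: SerreLocalFields1979, Ch. II §4 Lemma 1] -/
protected noncomputable def zero : Data ι R := ⟨0, 0, 0⟩

/-- **The composition law** as an operation on data (ours): `(A,Θ,c) ∘ (A′,Θ′,c′) = (A + A′ + Σ_t c_tΘ′_{t,·}, Θ + Θ′, c + c′)`.
[cite: SerreLocalFields1979, Ch. II §4 Lemma 1] -/
noncomputable def comp (ys : Finset ι) (D D' : Data ι R) : Data ι R :=
  ⟨fun x => D.A x + D'.A x + ∑ t ∈ ys, D.c t * D'.Θ t x, fun t x => D.Θ t x + D'.Θ t x, fun t => D.c t + D'.c t⟩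

/-- The data of the `n`-th power (ours): `D^{n+1} = D ∘ D^n`. [cite: SerreLocalFields1979, Ch. II §4 Lemma 1] -/
noncomputable def pow (ys : Finset ι) (D : Data ι R) : ℕ → Data ι R
  | 0 => Data.zero
  | n + 1 => D.comp ys (D.pow ys n)

variable (ys : Finset ι) (D D' : Data ι R)

/-- Plumbing (ours). [cite: SerreLocalFields1979, Ch. II §4 Lemma 1] -/
@[simp] theorem zero_A (x : ι) : (Data.zero : Data ι R).A x = 0 := rfl
/-- Plumbing (ours). [cite: SerreLocalFields1979, Ch. II §4 Lemma 1] -/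
@[simp] theorem zero_Θ (t x : ι) : (Data.zero : Data ι R).Θ t x = 0 := rfl
/-- Plumbing (ours). [cite: SerreLocalFields1979, Ch. II §4 Lemma 1] -/
@[simp] theorem zero_c (t : ι) : (Data.zero : Data ι R).c t = 0 := rfl
/-- Plumbing (ours). [cite: SerreLocalFields1979, Ch. II §4 Lemma 1] -/
@[simp] theorem comp_A (x : ι) : (D.comp ys D').A x = D.A x + D'.A x + ∑ t ∈ ys, D.c t * D'.Θ t x := rfl
/-- Plumbing (ours). [cite: SerreLocalFields1979, Ch. II §4 Lemma 1] -/
@[simp] theorem comp_Θ (t x : ι) : (D.comp ys D').Θ t x = D.Θ t x + D'.Θ t x := rfl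
/-- Plumbing (ours). [cite: SerreLocalFields1979, Ch. II §4 Lemma 1] -/
@[simp] theorem comp_c (t : ι) : (D.comp ys D').c t = D.c t + D'.c t := rfl
/-- Plumbing (ours). [cite: SerreLocalFields1979, Ch. II §4 Lemma 1] -/
@[simp] theorem pow_zero_eq : D.pow ys 0 = Data.zero := rfl
/-- Plumbing (ours). [cite: SerreLocalFields1979, Ch. II §4 Lemma 1] -/
@[simp] theorem pow_succ_eq (n : ℕ) : D.pow ys (n + 1) = D.comp ys (D.pow ys n) := rfl

/-- `Θ` is additive: `Θ^{(n)} = nΘ` (ours). [cite: SerreLocalFields1979, Ch. II §4 Lemma 1] -/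
theorem pow_Θ (n : ℕ) (t x : ι) : (D.pow ys n).Θ t x = n • D.Θ t x := by
  induction n with
  | zero => simp
  | succ n ih => rw [pow_succ_eq, comp_Θ, ih, succ_nsmul']

/-- `c` is additive: `c^{(n)} = nc` (ours). [cite: SerreLocalFields1979, Ch. II §4 Lemma 1] -/
theorem pow_c (n : ℕ) (t : ι) : (D.pow ys n).c t = n • D.c t := by
  induction n with
  | zero => simp
  | succ n ih => rw [pow_succ_eq, comp_c, ih, succ_nsmul']

/-- **The `A`-coordinate of `Φ^n`** (ours): `A^{(n)} = nA + (n choose 2)·Σ_t c_t Θ_{t,·}`. [cite: SerreLocalFields1979, Ch. II §4 Lemma 1] -/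
theorem pow_A (n : ℕ) (x : ι) :
    (D.pow ys n).A x = n • D.A x + (n.choose 2) • ∑ t ∈ ys, D.c t * D.Θ t x := by
  induction n with
  | zero => simp
  | succ n ih =>
    rw [pow_succ_eq, comp_A, ih]
    have hΘ : ∑ t ∈ ys, D.c t * (D.pow ys n).Θ t x = n • ∑ t ∈ ys, D.c t * D.Θ t x := by
      rw [Finset.smul_sum]
      exact Finset.sum_congr rfl fun t _ => by rw [pow_Θ, mul_smul_comm]
    rw [hΘ, Nat.choose_succ_succ', Nat.choose_one_right, succ_nsmul', add_nsmul]
    abel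

/-- With `Θ = Θ′ = 0` the composition is coordinatewise addition (ours; T91's situation). [cite: SerreLocalFields1979, Ch. II §4 Lemma 1] -/
theorem comp_of_Θ_eq_zero (hΘ : D.Θ = 0) (hΘ' : D'.Θ = 0) :
    D.comp ys D' = ⟨fun x => D.A x + D'.A x, 0, fun t => D.c t + D'.c t⟩ := by
  obtain ⟨A, Θ, c⟩ := D
  obtain ⟨A', Θ', c'⟩ := D'
  simp only at hΘ hΘ'
  subst hΘ hΘ'
  simp only [comp, Pi.zero_apply, mul_zero, Finset.sum_const_zero, add_zero]
  rfl

/-- … and symmetric (ours). [cite: SerreLocalFields1979, Ch. II §4 Lemma 1] -/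
theorem comp_comm_of_Θ_eq_zero (hΘ : D.Θ = 0) (hΘ' : D'.Θ = 0) : D.comp ys D' = D'.comp ys D := by
  rw [comp_of_Θ_eq_zero ys D D' hΘ hΘ', comp_of_Θ_eq_zero ys D' D hΘ' hΘ]
  congr 1
  · funext x; rw [add_comm]
  · funext t; rw [add_comm]

end Data

/-! ## Unipotent substitutions -/

/-- `Φ` is **the unipotent substitution with data `D = (A, Θ, c)`** for the sorts `zs` (fixed), `ys` (translated), rest (sheared):
`z ↦ z`, `y_t ↦ y_t + c_t`, `x ↦ x + A_x + Σ_{t∈ys} y_tΘ_{t,x}`, all data in `R[z]` (ours). [cite: SerreLocalFields1979, Ch. II §4 Lemma 1] -/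
structure IsUnipotentBy (zs ys : Finset ι) (D : Data ι R) (Φ : MvPolynomial ι R →ₐ[R] MvPolynomial ι R) : Prop where
  /-- `z ↦ z` -/
  map_z : ∀ z ∈ zs, Φ (X z) = X z
  /-- `y_t ↦ y_t + c_t` -/
  map_y : ∀ t ∈ ys, Φ (X t) = X t + D.c t
  /-- `x ↦ x + A_x + Σ_t y_t Θ_{t,x}` -/
  map_x : ∀ x, x ∉ zs → x ∉ ys → Φ (X x) = X x + D.A x + ∑ t ∈ ys, X t * D.Θ t x
  /-- `A_x ∈ R[z]` -/
  overA : ∀ x, IsOverZ zs (D.A x)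
  /-- `Θ_{t,x} ∈ R[z]` -/
  overΘ : ∀ t x, IsOverZ zs (D.Θ t x)
  /-- `c_t ∈ R[z]` -/
  overc : ∀ t, IsOverZ zs (D.c t)

namespace IsUnipotentBy

variable {zs ys : Finset ι} {D D' : Data ι R} {Φ Φ' : MvPolynomial ι R →ₐ[R] MvPolynomial ι R}

/-- `Φ` fixes `R[z]` pointwise (ours; the reason for the composition law). [cite: SerreLocalFields1979, Ch. II §4 Lemma 1] -/
theorem apply_eq_self (h : IsUnipotentBy zs ys D Φ) {q : MvPolynomial ι R} (hq : IsOverZ zs q) : Φ q = q := by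
  have key := MvPolynomial.hom_congr_vars (f₁ := (Φ : MvPolynomial ι R →+* MvPolynomial ι R)) (f₂ := RingHom.id _)
    (p₁ := q) (p₂ := q) (by ext r; simp only [RingHom.comp_apply, RingHom.coe_coe, MvPolynomial.algHom_C, algebraMap_eq, RingHom.id_apply])
    (fun j hj _ => by rw [RingHom.coe_coe, RingHom.id_apply, h.map_z j (hq j hj)]) rfl
  simpa using key

/-- **T95, the composition law** (ours): `Φ_D ∘ Φ_{D′} = Φ_{D ∘ D′}` with `D ∘ D′ = (A + A′ + Σ_t c_tΘ′_{t,·}, Θ + Θ′, c + c′)`.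
[cite: SerreLocalFields1979, Ch. II §4 Lemma 1] -/
theorem comp [DecidableEq ι] (h : IsUnipotentBy zs ys D Φ) (h' : IsUnipotentBy zs ys D' Φ') :
    IsUnipotentBy zs ys (D.comp ys D') (Φ.comp Φ') where
  map_z z hz := by rw [AlgHom.comp_apply, h'.map_z z hz, h.map_z z hz]
  map_y t ht := by rw [AlgHom.comp_apply, h'.map_y t ht, map_add, h.map_y t ht, h.apply_eq_self (h'.overc t), Data.comp_c, add_assoc]
  map_x x hxz hxy := by
    have hs : Φ (∑ t ∈ ys, X t * D'.Θ t x) = ∑ t ∈ ys, (X t + D.c t) * D'.Θ t x := by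
      rw [map_sum]
      exact Finset.sum_congr rfl fun t ht => by rw [map_mul, h.map_y t ht, h.apply_eq_self (h'.overΘ t x)]
    rw [AlgHom.comp_apply, h'.map_x x hxz hxy, map_add, map_add, h.map_x x hxz hxy, h.apply_eq_self (h'.overA x), hs,
      Data.comp_A]
    simp only [Data.comp_Θ, Finset.sum_add_distrib, add_mul, mul_add]
    ring
  overA x := ((h.overA x).add (h'.overA x)).add (IsOverZ.sum fun t _ => (h.overc t).mul (h'.overΘ t x))
  overΘ t x := (h.overΘ t x).add (h'.overΘ t x)
  overc t := (h.overc t).add (h'.overc t)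

/-- The substitution is determined by its data (ours). [cite: SerreLocalFields1979, Ch. II §4 Lemma 1] -/
theorem unique [DecidableEq ι] (h₁ : IsUnipotentBy zs ys D Φ) (h₂ : IsUnipotentBy zs ys D Φ') : Φ = Φ' := by
  refine MvPolynomial.algHom_ext fun x => ?_
  by_cases hz : x ∈ zs
  · rw [h₁.map_z x hz, h₂.map_z x hz]
  · by_cases hy : x ∈ ys
    · rw [h₁.map_y x hy, h₂.map_y x hy]
    · rw [h₁.map_x x hz hy, h₂.map_x x hz hy]

end IsUnipotentBy

/-- `Φ_0 = id` (ours). [cite: SerreLocalFields1979, Ch. II §4 Lemma 1] -/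
theorem isUnipotentBy_id (zs ys : Finset ι) : IsUnipotentBy zs ys (Data.zero : Data ι R) (AlgHom.id R (MvPolynomial ι R)) where
  map_z _ _ := rfl
  map_y t _ := by rw [AlgHom.coe_id, id_eq, Data.zero_c, add_zero]
  map_x x _ _ := by simp
  overA _ := IsOverZ.zero
  overΘ _ _ := IsOverZ.zero
  overc _ := IsOverZ.zero

/-- **The powers** (ours): `Φ^n = Φ_{D^n}`, with `D^n = (nA + (n choose 2)Σ_t c_tΘ_{t,·}, nΘ, nc)` by `Data.pow_A/_Θ/_c`.
[cite: SerreLocalFields1979, Ch. II §4 Lemma 1] -/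
theorem IsUnipotentBy.pow [DecidableEq ι] {zs ys : Finset ι} {D : Data ι R} {Φ : MvPolynomial ι R →ₐ[R] MvPolynomial ι R}
    (h : IsUnipotentBy zs ys D Φ) : ∀ n : ℕ, IsUnipotentBy zs ys (D.pow ys n) (Φ ^ n)
  | 0 => by rw [pow_zero]; exact isUnipotentBy_id zs ys
  | n + 1 => by rw [pow_succ']; exact h.comp (h.pow n)

/-- With `Θ = 0` on both sides the substitutions COMMUTE (ours; the abelian subgroup of T91). [cite: SerreLocalFields1979, Ch. II §4 Lemma 1] -/
theorem comp_comm_of_Θ_eq_zero [DecidableEq ι] {zs ys : Finset ι} {D D' : Data ι R}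
    {Φ Φ' : MvPolynomial ι R →ₐ[R] MvPolynomial ι R} (h : IsUnipotentBy zs ys D Φ) (h' : IsUnipotentBy zs ys D' Φ')
    (hΘ : D.Θ = 0) (hΘ' : D'.Θ = 0) : Φ.comp Φ' = Φ'.comp Φ := by
  have h1 := h.comp h'
  rw [Data.comp_comm_of_Θ_eq_zero ys D D' hΘ hΘ'] at h1
  exact h1.unique (h'.comp h)

/-! ## The construction -/

section Construction

variable [DecidableEq ι] (zs ys : Finset ι) (D : Data ι R)

/-- `Φ_D` as a substitution (construction, ours; `zs` takes precedence over `ys`). [cite: SerreLocalFields1979, Ch. II §4 Lemma 1] -/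
noncomputable def unipotentHom : MvPolynomial ι R →ₐ[R] MvPolynomial ι R :=
  aeval fun x => if x ∈ zs then X x else if x ∈ ys then X x + D.c x else X x + D.A x + ∑ t ∈ ys, X t * D.Θ t x

/-- Plumbing (ours). [cite: SerreLocalFields1979, Ch. II §4 Lemma 1] -/
theorem unipotentHom_X (x : ι) : unipotentHom zs ys D (X x) =
    if x ∈ zs then X x else if x ∈ ys then X x + D.c x else X x + D.A x + ∑ t ∈ ys, X t * D.Θ t x := by
  rw [unipotentHom, aeval_X]

/-- `Φ_D` is the unipotent substitution with data `D` as soon as `ys ∩ zs = ∅` and the data lie in `R[z]` (ours).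
[cite: SerreLocalFields1979, Ch. II §4 Lemma 1] -/
theorem isUnipotentBy_unipotentHom (hdisj : ∀ t ∈ ys, t ∉ zs) (hA : ∀ x, IsOverZ zs (D.A x))
    (hΘ : ∀ t x, IsOverZ zs (D.Θ t x)) (hc : ∀ t, IsOverZ zs (D.c t)) : IsUnipotentBy zs ys D (unipotentHom zs ys D) where
  map_z z hz := by rw [unipotentHom_X, if_pos hz]
  map_y t ht := by rw [unipotentHom_X, if_neg (hdisj t ht), if_pos ht]
  map_x x hxz hxy := by rw [unipotentHom_X, if_neg hxz, if_neg hxy]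
  overA := hA
  overΘ := hΘ
  overc := hc

end Construction

/-! ## A worked instance -/

/-- Smoke test (ours): one slot of each sort (`0 = x`, `1 = y`, `2 = z`) over `ℤ`, `A = z`, `Θ = z²`, `c = 2z`:
`(Φ∘Φ)(x) = x + (2z + 2z·z²) + y·(2z²)`, as the composition law predicts. [cite: SerreLocalFields1979, Ch. II §4 Lemma 1] -/
example :
    let D : Data (Fin 3) ℤ := ⟨fun _ => X 2, fun _ _ => X 2 ^ 2, fun _ => 2 * X 2⟩
    (D.comp {1} D).A 0 = X 2 + X 2 + 2 * X 2 * X 2 ^ 2 := by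
  simp [Data.comp]

end UnipotentComposition

end Literature.AlgebraicGeometry.Resolution.WeightedBlowup
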